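import Summits.AtomisticToContinuum.Crystallization.Theorems.ChargedEnergyGapDominoLedgerA
import HarnessLib

/-!
# lens-3 NODE 89 «DominoLedger» — part 2 of 3 (sequel of `…ChargedEnergyGapDominoLedgerA`)

Split for the 400-line cap by the landing lane (hand-2 g41); the module docstring of part 1 (`…ChargedEnergyGapDominoLedgerA`) describes the whole node.  Same namespace; all FQNs unchanged.
0 sorry; standard axioms.
-/

noncomputable section
open scoped Classical
open Literature.MathematicalPhysics.StatisticalMechanics Literature.Geometry.DiscreteGeometry
open Summit.AtomisticToContinuum.Crystallization.Theses.PricedLinkCensus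
open Summit.AtomisticToContinuum.Crystallization.Theorems.ChargedEnergyGapNegative

namespace Summit.AtomisticToContinuum.Crystallization.Theorems.ChargedEnergyGapChartDial

/-! ## §89.4 Glue: (DL) ∧ (DT) ⟹ (M¹) -/
section Glue89

variable {ϱχ : ℝ} {m : ℕ} {D : Fin m → Set E3} {σ : Fin m → Bool}

/-- ★ **SPLIT OF THE TRUE LOAD (PROVED)**: `ballLoad = ballRest + ballLine` (finite pair box of a separated reference). -/
theorem dl_ballLoad_eq_rest_add_line {s R_N r_f dK dstar κ c_T cχ τ ϱ r₁ r₂ : ℝ} {P : PeriodicConfiguration 3} {C X : Set E3}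
    (h1 : IsSeparatedRef s P) (hs : 0 < s) (x : E3) :
    ballLoad ϱχ D σ R_N r_f dK dstar κ c_T cχ P C X τ ϱ r₁ r₂ x =
      ballRest ϱχ D σ R_N r_f dK dstar κ c_T cχ P C X τ ϱ r₁ r₂ x + ballLine ϱχ D σ R_N r_f dK dstar κ c_T cχ P C X τ ϱ r₁ r₂ x := by
  unfold ballLoad ballRest ballLine
  set B := (fz_pairBox_finite (ϱχ := ϱχ) (D := D) (σ := σ) (R_N := R_N) (r_f := r_f) (dK := dK) (dstar := dstar) (κ := κ) (c_T := c_T)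
    (cχ := cχ) (τ := τ) (ϱ := ϱ) (r₁ := r₁) (r₂ := r₂) (C := C) (X := X) h1 hs x).toFinset with hB
  have hsupp : ∀ F : E3 × E3 → ℝ, (∀ p, F p ≠ 0 → HeavyActive ϱχ D σ r_f dK dstar κ c_T cχ P C X τ ϱ r₁ r₂ p.1 p.2 ∧ dist x p.1 ≤ R_N) →
      Function.support F ⊆ ↑B := by
    intro F hF p hp
    rw [hB, Set.Finite.coe_toFinset, Set.mem_setOf_eq]
    exact hF p hp
  have hpt : ∀ p : E3 × E3,
      (if HeavyActive ϱχ D σ r_f dK dstar κ c_T cχ P C X τ ϱ r₁ r₂ p.1 p.2 ∧ dist x p.1 ≤ R_N then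
          (1 / 6) * frameVal (roofVal T75) τ (siteW ϱχ D σ X ϱ C) P r₁ p.1 p.2 else 0) =
        (if (HeavyActive ϱχ D σ r_f dK dstar κ c_T cχ P C X τ ϱ r₁ r₂ p.1 p.2 ∧ dist x p.1 ≤ R_N) ∧ ¬IsLinePair ϱχ D P C r₁ p.1 p.2 then
            (1 / 6) * frameVal (roofVal T75) τ (siteW ϱχ D σ X ϱ C) P r₁ p.1 p.2 else 0) +
          (if (HeavyActive ϱχ D σ r_f dK dstar κ c_T cχ P C X τ ϱ r₁ r₂ p.1 p.2 ∧ dist x p.1 ≤ R_N) ∧ IsLinePair ϱχ D P C r₁ p.1 p.2 then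
            (1 / 6) * frameVal (roofVal T75) τ (siteW ϱχ D σ X ϱ C) P r₁ p.1 p.2 else 0) := by
    intro p
    by_cases hA : HeavyActive ϱχ D σ r_f dK dstar κ c_T cχ P C X τ ϱ r₁ r₂ p.1 p.2 ∧ dist x p.1 ≤ R_N
    · by_cases hL : IsLinePair ϱχ D P C r₁ p.1 p.2
      · rw [if_pos hA, if_neg (fun h => h.2 hL), if_pos ⟨hA, hL⟩, zero_add]
      · rw [if_pos hA, if_pos ⟨hA, hL⟩, if_neg (fun h => hL h.2), add_zero]
    · rw [if_neg hA, if_neg (fun h => hA h.1), if_neg (fun h => hA h.1), add_zero]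
  rw [finsum_congr hpt]
  refine finsum_add_distrib (B.finite_toSet.subset (hsupp _ fun p hp => ?_)) (B.finite_toSet.subset (hsupp _ fun p hp => ?_))
  · by_contra hc
    exact hp (if_neg fun h => hc h.1)
  · by_contra hc
    exact hp (if_neg fun h => hc h.1)

/-- ★ **THE MARKED HOLES AT `x` ARE FINITELY MANY (PROVED)**: the lattice map is injective and the pair box is finite. -/
theorem dl_marked_finite {s R_N r_f dK dstar κ c_T cχ τ ϱ r₁ r₂ : ℝ} {P : PeriodicConfiguration 3} {C X : Set E3} {c₀ : E3}
    {f : Fin 3 → E3} {ρ : ℝ} (h1 : IsSeparatedRef s P) (hs : 0 < s) (hf : Orthonormal ℝ f) (hρ : 0 < ρ) (x : E3) :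
    Set.Finite {w : Fin 3 → ℤ | IsMarked ϱχ D σ R_N r_f dK dstar κ c_T cχ P C X τ ϱ r₁ r₂ c₀ f ρ x w} := by
  have hB := fz_pairBox_finite (ϱχ := ϱχ) (D := D) (σ := σ) (R_N := R_N) (r_f := r_f) (dK := dK) (dstar := dstar) (κ := κ) (c_T := c_T)
    (cχ := cχ) (τ := τ) (ϱ := ϱ) (r₁ := r₁) (r₂ := r₂) (C := C) (X := X) h1 hs x
  have hfin : ((cubicPt c₀ f ρ) ⁻¹' ((fun p : E3 × E3 => octCentre p.1 p.2) ''
      {p : E3 × E3 | HeavyActive ϱχ D σ r_f dK dstar κ c_T cχ P C X τ ϱ r₁ r₂ p.1 p.2 ∧ dist x p.1 ≤ R_N})).Finite :=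
    (hB.image _).preimage (lm_cubicPt_injective hf hρ.ne').injOn
  refine hfin.subset ?_
  rintro w ⟨-, y', z', hH, -, hnear, hcen⟩
  exact ⟨(y', z'), ⟨hH, hnear⟩, hcen⟩

/-- ★★ **HOLE RE-INDEXING AT TRUE COST (PROVED)**: in a cubic frame the thawed line part at `x` is at most the sum of the thawed hole costs of the
holes MARKED at `x` — every line pair is an axis-antipodal pole pair of the frame octahedron of an odd hole ((LS)), the pole-pair map of a hole is
injective, and the hole of a pair near `x` is marked.  No table. -/
theorem dl_ballLine_le_marked {s R_N r_f dK dstar κ c_T cχ τ ϱ r₁ r₂ : ℝ} {P : PeriodicConfiguration 3} {C X : Set E3} {c₀ : E3}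
    {f : Fin 3 → E3} {ρ : ℝ} (h1 : IsSeparatedRef s P) (hs : 0 < s) (hf : Orthonormal ℝ f) (hρ : 0 < ρ)
    (hCF : IsCubicFrameOf P r₁ r₂ c₀ f ρ) (x : E3) :
    ballLine ϱχ D σ R_N r_f dK dstar κ c_T cχ P C X τ ϱ r₁ r₂ x ≤
      ∑ᶠ w : Fin 3 → ℤ, (if IsMarked ϱχ D σ R_N r_f dK dstar κ c_T cχ P C X τ ϱ r₁ r₂ c₀ f ρ x w then
        holeCost τ (siteW ϱχ D σ X ϱ C) P r₁ c₀ f ρ w else 0) := by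
  -- abbreviations
  set W := siteW ϱχ D σ X ϱ C with hW
  set A : E3 × E3 → Prop := fun p =>
    (HeavyActive ϱχ D σ r_f dK dstar κ c_T cχ P C X τ ϱ r₁ r₂ p.1 p.2 ∧ dist x p.1 ≤ R_N) ∧ IsLinePair ϱχ D P C r₁ p.1 p.2 with hA
  set g : E3 × E3 → ℝ := fun p => (1 / 6) * frameVal (roofVal T75) τ W P r₁ p.1 p.2 with hg
  set g' : E3 × E3 → ℝ := fun p => (1 / 6) * max 0 (frameVal (roofVal T75) τ W P r₁ p.1 p.2) with hg'
  set mk := IsMarked ϱχ D σ R_N r_f dK dstar κ c_T cχ P C X τ ϱ r₁ r₂ c₀ f ρ x with hmk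
  set h : (Fin 3 → ℤ) → ℝ := fun w => holeCost τ W P r₁ c₀ f ρ w with hh
  -- the finite set of line pairs near `x`
  set B := (fz_pairBox_finite (ϱχ := ϱχ) (D := D) (σ := σ) (R_N := R_N) (r_f := r_f) (dK := dK) (dstar := dstar) (κ := κ) (c_T := c_T)
    (cχ := cχ) (τ := τ) (ϱ := ϱ) (r₁ := r₁) (r₂ := r₂) (C := C) (X := X) h1 hs x).toFinset with hB
  set S := B.filter A with hS
  have hS_mem : ∀ p, p ∈ S ↔ A p := by
    intro p
    rw [hS, Finset.mem_filter, hB, Set.Finite.mem_toFinset, Set.mem_setOf_eq]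
    exact ⟨fun hp => hp.2, fun hp => ⟨hp.1, hp⟩⟩
  -- the line part is a finite sum
  have hL : ballLine ϱχ D σ R_N r_f dK dstar κ c_T cχ P C X τ ϱ r₁ r₂ x = ∑ p ∈ S, g p := by
    unfold ballLine
    rw [finsum_eq_sum_of_support_subset _ (show (Function.support fun p : E3 × E3 => if A p then g p else 0) ⊆ ↑S from ?_)]
    · exact Finset.sum_congr rfl fun p hp => if_pos ((hS_mem p).1 hp)
    · intro p hp
      rw [Function.mem_support] at hp
      rw [Finset.mem_coe, hS_mem]
      by_contra hc
      exact hp (if_neg hc)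
  -- the mid-pair window of a line pair
  have hmid : ∀ p : E3 × E3, A p → p.1 ∈ P.points ∧ p.2 ∈ P.points ∧ r₁ < dist p.1 p.2 ∧ dist p.1 p.2 ≤ r₂ :=
    fun p hp => hp.1.1.1.1
  -- the hole of a line pair ((LS))
  let hole : E3 × E3 → (Fin 3 → ℤ) := fun p =>
    if hp : A p then Classical.choose (hCF.2 p.1 p.2 (hmid p hp).1 (hmid p hp).2.1 (hmid p hp).2.2.1 (hmid p hp).2.2.2) else 0
  have hspec : ∀ p : E3 × E3, A p → ∃ (a : Fin 3) (b : Bool), Odd (∑ i, hole p i) ∧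
      p.1 = octVertex (cubicPt c₀ f ρ (hole p)) f ρ a (!b) ∧ p.2 = octVertex (cubicPt c₀ f ρ (hole p)) f ρ a b ∧
        ∀ x', InOct P r₁ p.1 p.2 x' ↔ ∃ (i : Fin 3) (b' : Bool), x' = octVertex (cubicPt c₀ f ρ (hole p)) f ρ i b' := by
    intro p hp
    have hc := Classical.choose_spec (hCF.2 p.1 p.2 (hmid p hp).1 (hmid p hp).2.1 (hmid p hp).2.2.1 (hmid p hp).2.2.2)
    have he : hole p = Classical.choose (hCF.2 p.1 p.2 (hmid p hp).1 (hmid p hp).2.1 (hmid p hp).2.2.1 (hmid p hp).2.2.2) := dif_pos hp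
    rw [he]
    exact hc
  -- fibrewise over the holes
  set t := S.image hole with ht
  have hfib : ∑ p ∈ S, g p = ∑ w ∈ t, ∑ p ∈ S with hole p = w, g p :=
    (Finset.sum_fiberwise_of_maps_to (fun p hp => Finset.mem_image_of_mem hole hp) g).symm
  -- each fibre injects into the six ordered pole pairs of its hole and pays at most the clipped sixth-costs
  have hfib_le : ∀ w ∈ t, ∑ p ∈ S with hole p = w, g p ≤ h w := by
    intro w _
    set pp : Fin 3 × Bool → E3 × E3 := fun u =>
      (octVertex (cubicPt c₀ f ρ w) f ρ u.1 (!u.2), octVertex (cubicPt c₀ f ρ w) f ρ u.1 u.2) with hpp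
    have hsub : (S.filter fun p => hole p = w) ⊆ (Finset.univ : Finset (Fin 3 × Bool)).image pp := by
      intro p hp
      rw [Finset.mem_filter] at hp
      obtain ⟨a, b, -, hy, hz, -⟩ := hspec p ((hS_mem p).1 hp.1)
      rw [hp.2] at hy hz
      rw [Finset.mem_image]
      exact ⟨(a, b), Finset.mem_univ _, Prod.ext hy.symm hz.symm⟩
    have hgg' : ∀ p, g p ≤ g' p := fun p => mul_le_mul_of_nonneg_left (le_max_right _ _) (by norm_num)
    have hg'0 : ∀ p, 0 ≤ g' p := fun p => mul_nonneg (by norm_num) (le_max_left _ _)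
    calc ∑ p ∈ S with hole p = w, g p ≤ ∑ p ∈ S with hole p = w, g' p := Finset.sum_le_sum fun p _ => hgg' p
      _ ≤ ∑ p ∈ (Finset.univ : Finset (Fin 3 × Bool)).image pp, g' p :=
          Finset.sum_le_sum_of_subset_of_nonneg hsub fun p _ _ => hg'0 p
      _ ≤ ∑ u : Fin 3 × Bool, g' (pp u) := Finset.sum_image_le_of_nonneg fun p _ => hg'0 p
      _ = h w := by
          rw [hh, hg', hpp]
          unfold holeCost
          rfl
  -- the holes of the line pairs near `x` are exactly the marked holes
  have ht_marked : ∀ w ∈ t, mk w := by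
    intro w hw
    rw [ht, Finset.mem_image] at hw
    obtain ⟨p, hpS, rfl⟩ := hw
    have hAp := (hS_mem p).1 hpS
    obtain ⟨a, b, hodd, hy, hz, -⟩ := hspec p hAp
    refine ⟨hodd, p.1, p.2, hAp.1.1, hAp.2, hAp.1.2, ?_⟩
    rw [hy, hz, lm_octCentre_poles]
  have hmarked_t : ∀ w, mk w → w ∈ t := by
    rintro w ⟨-, y', z', hH, hLp, hnear, hcen⟩
    have hAp : A (y', z') := ⟨⟨hH, hnear⟩, hLp⟩
    have hpS : (y', z') ∈ S := (hS_mem _).2 hAp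
    obtain ⟨a, b, -, hy, hz, -⟩ := hspec (y', z') hAp
    have hc : cubicPt c₀ f ρ (hole (y', z')) = cubicPt c₀ f ρ w := by
      have hcp := lm_octCentre_poles (cubicPt c₀ f ρ (hole (y', z'))) f ρ a b
      simp only at hy hz
      rw [← hy, ← hz, hcen] at hcp
      exact hcp.symm
    rw [← lm_cubicPt_injective hf hρ.ne' hc, ht]
    exact Finset.mem_image_of_mem hole hpS
  have hM : ∑ᶠ w, (if mk w then h w else 0) = ∑ w ∈ t, h w := by
    rw [finsum_eq_sum_of_support_subset _ (show (Function.support fun w => if mk w then h w else 0) ⊆ ↑t from ?_)]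
    · exact Finset.sum_congr rfl fun w hw => if_pos (ht_marked w hw)
    · intro w hw
      rw [Function.mem_support] at hw
      rw [Finset.mem_coe]
      refine hmarked_t w ?_
      by_contra hc
      exact hw (if_neg hc)
  -- assemble
  rw [hL, hfib, hM]
  exact Finset.sum_le_sum hfib_le

/-- ★★ **DOMINO REGROUPING (PROVED)**: if the marked set is finite, hole charges are non-negative and every DOMINANT marked hole's domino sum is at
most its cap, then the total marked charge is at most the sum of the caps of the dominant holes — every domino class of a finite marked set has a
unique rank-maximal marked hole, which is dominant, and the classes partition the marked set.  Pure combinatorics (any `mk`, `d`, `hc`). -/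
theorem dl_marked_le_dominant {unit ϱ τ ρ : ℝ} {d : (Fin 3 → ℤ) → ℝ} {mk : (Fin 3 → ℤ) → Prop} {hc : (Fin 3 → ℤ) → ℝ}
    (hfin : Set.Finite {w | mk w}) (hc0 : ∀ w, 0 ≤ hc w)
    (hlaw : ∀ w, IsDominant unit ϱ τ ρ d mk w →
      ∑ᶠ w', (if mk w' ∧ SameDomino ρ d w w' then hc w' else 0) ≤ domCap unit ϱ τ ρ (chargeDepth ρ d w)) :
    ∑ᶠ w, (if mk w then hc w else 0) ≤ ∑ᶠ w, (if IsDominant unit ϱ τ ρ d mk w then domCap unit ϱ τ ρ (chargeDepth ρ d w) else 0) := by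
  set t := hfin.toFinset with ht
  have ht_mem : ∀ w, w ∈ t ↔ mk w := fun w => by rw [ht, Set.Finite.mem_toFinset, Set.mem_setOf_eq]
  set R := domRank unit ϱ τ ρ d with hR
  set cap : (Fin 3 → ℤ) → ℝ := fun w => domCap unit ϱ τ ρ (chargeDepth ρ d w) with hcap
  -- the representative of a marked hole: the rank-maximal marked hole of its domino
  have hne : ∀ w ∈ t, (t.filter fun w' => SameDomino ρ d w w').Nonempty :=
    fun w hw => ⟨w, Finset.mem_filter.2 ⟨hw, sameDomino_refl ρ d w⟩⟩
  let rep : (Fin 3 → ℤ) → (Fin 3 → ℤ) := fun w =>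
    if hw : w ∈ t then Classical.choose (Finset.exists_max_image _ R (hne w hw)) else w
  have hrep : ∀ w ∈ t, rep w ∈ t ∧ SameDomino ρ d w (rep w) ∧ ∀ w' ∈ t, SameDomino ρ d w w' → R w' ≤ R (rep w) := by
    intro w hw
    have hsp := Classical.choose_spec (Finset.exists_max_image _ R (hne w hw))
    have he : rep w = Classical.choose (Finset.exists_max_image _ R (hne w hw)) := dif_pos hw
    rw [he]
    obtain ⟨hm, hmax⟩ := hsp
    rw [Finset.mem_filter] at hm
    exact ⟨hm.1, hm.2, fun w' hw' hsd => hmax w' (Finset.mem_filter.2 ⟨hw', hsd⟩)⟩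
  -- representatives are dominant
  have hdom : ∀ w ∈ t, IsDominant unit ϱ τ ρ d mk (rep w) := by
    intro w hw
    obtain ⟨hrt, hsd, hmax⟩ := hrep w hw
    exact ⟨(ht_mem _).1 hrt, fun w' hw' hsd' => hmax w' ((ht_mem _).2 hw') (hsd.trans hsd')⟩
  -- a dominant hole is its own representative
  have hfix : ∀ w, IsDominant unit ϱ τ ρ d mk w → w ∈ t ∧ rep w = w := by
    rintro w ⟨hw, hmax⟩
    have hwt := (ht_mem w).2 hw
    obtain ⟨hrt, hsd, hmax'⟩ := hrep w hwt
    refine ⟨hwt, domRank_injective unit ϱ τ ρ d (le_antisymm ?_ ?_)⟩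
    · exact hmax (rep w) ((ht_mem _).1 hrt) hsd
    · exact hmax' w hwt (sameDomino_refl ρ d w)
  -- the left side is a finite sum, fibrewise by representative
  have hL : ∑ᶠ w, (if mk w then hc w else 0) = ∑ w ∈ t, hc w := by
    rw [finsum_eq_sum_of_support_subset _ (show (Function.support fun w => if mk w then hc w else 0) ⊆ ↑t from ?_)]
    · exact Finset.sum_congr rfl fun w hw => if_pos ((ht_mem w).1 hw)
    · intro w hw
      rw [Function.mem_support] at hw
      rw [Finset.mem_coe, ht_mem]
      by_contra hc'
      exact hw (if_neg hc')
  set u := t.image rep with hu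
  have hfib : ∑ w ∈ t, hc w = ∑ r ∈ u, ∑ w ∈ t with rep w = r, hc w :=
    (Finset.sum_fiberwise_of_maps_to (fun w hw => Finset.mem_image_of_mem rep hw) hc).symm
  -- each fibre lies in the domino of its (dominant) representative: bounded by the law
  have hfib_le : ∀ r ∈ u, ∑ w ∈ t with rep w = r, hc w ≤ cap r := by
    intro r hr
    rw [hu, Finset.mem_image] at hr
    obtain ⟨w₀, hw₀, hrw⟩ := hr
    have hdr : IsDominant unit ϱ τ ρ d mk r := hrw ▸ hdom w₀ hw₀
    have hsub : (t.filter fun w => rep w = r) ⊆ t.filter fun w' => SameDomino ρ d r w' := by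
      intro w hw
      rw [Finset.mem_filter] at hw ⊢
      obtain ⟨hwt, hwr⟩ := hw
      have hsd := (hrep w hwt).2.1
      rw [hwr] at hsd
      exact ⟨hwt, hsd.symm⟩
    have hsum : ∑ᶠ w', (if mk w' ∧ SameDomino ρ d r w' then hc w' else 0) =
        ∑ w' ∈ t.filter (fun w' => SameDomino ρ d r w'), hc w' := by
      rw [finsum_eq_sum_of_support_subset _ (show (Function.support fun w' => if mk w' ∧ SameDomino ρ d r w' then hc w' else 0) ⊆
          ↑(t.filter fun w' => SameDomino ρ d r w') from ?_)]
      · refine Finset.sum_congr rfl fun w' hw' => ?_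
        rw [Finset.mem_filter] at hw'
        exact if_pos ⟨(ht_mem _).1 hw'.1, hw'.2⟩
      · intro w' hw'
        rw [Function.mem_support] at hw'
        rw [Finset.mem_coe, Finset.mem_filter, ht_mem]
        by_contra hc'
        exact hw' (if_neg hc')
    calc ∑ w ∈ t with rep w = r, hc w ≤ ∑ w' ∈ t.filter (fun w' => SameDomino ρ d r w'), hc w' :=
          Finset.sum_le_sum_of_subset_of_nonneg hsub fun w _ _ => hc0 w
      _ = ∑ᶠ w', (if mk w' ∧ SameDomino ρ d r w' then hc w' else 0) := hsum.symm
      _ ≤ cap r := hlaw r hdr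
  -- the right side is the sum of the caps over the representatives
  have hRHS : ∑ᶠ w, (if IsDominant unit ϱ τ ρ d mk w then cap w else 0) = ∑ r ∈ u, cap r := by
    rw [finsum_eq_sum_of_support_subset _ (show (Function.support fun w => if IsDominant unit ϱ τ ρ d mk w then cap w else 0) ⊆ ↑u
        from ?_)]
    · refine Finset.sum_congr rfl fun r hr => ?_
      rw [hu, Finset.mem_image] at hr
      obtain ⟨w₀, hw₀, hrw⟩ := hr
      exact if_pos (hrw ▸ hdom w₀ hw₀)
    · intro w hw
      rw [Function.mem_support] at hw
      have hdw : IsDominant unit ϱ τ ρ d mk w := by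
        by_contra hc'
        exact hw (if_neg hc')
      obtain ⟨hwt, hfx⟩ := hfix w hdw
      rw [Finset.mem_coe, hu, Finset.mem_image]
      exact ⟨w, hwt, hfx⟩
  rw [hL, hfib, hRHS]
  exact Finset.sum_le_sum hfib_le

/-- ★★ **DOMINATION OF THE LOAD (PROVED)**: under the domino law at `x`, `ballLoad(x) ≤ domLoad(x)`. -/
theorem dl_ballLoad_le_domLoad {s R_N unit r_f dK dstar κ c_T cχ τ ϱ r₁ r₂ : ℝ} {P : PeriodicConfiguration 3} {C X : Set E3} {c₀ : E3}
    {f : Fin 3 → E3} {ρ : ℝ} (h1 : IsSeparatedRef s P) (hs : 0 < s) (hf : Orthonormal ℝ f) (hρ : 0 < ρ)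
    (hCF : IsCubicFrameOf P r₁ r₂ c₀ f ρ) (x : E3)
    (hlaw : ∀ w : Fin 3 → ℤ,
      IsDominant unit ϱ τ ρ (latDepth C c₀ f ρ) (IsMarked ϱχ D σ R_N r_f dK dstar κ c_T cχ P C X τ ϱ r₁ r₂ c₀ f ρ x) w →
      domSum ϱχ D σ R_N r_f dK dstar κ c_T cχ P C X τ ϱ r₁ r₂ c₀ f ρ x w ≤ domCap unit ϱ τ ρ (chargeDepth ρ (latDepth C c₀ f ρ) w)) :
    ballLoad ϱχ D σ R_N r_f dK dstar κ c_T cχ P C X τ ϱ r₁ r₂ x ≤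
      domLoad ϱχ D σ R_N unit r_f dK dstar κ c_T cχ P C X τ ϱ r₁ r₂ c₀ f ρ x := by
  rw [dl_ballLoad_eq_rest_add_line h1 hs x]
  unfold domLoad
  exact add_le_add le_rfl ((dl_ballLine_le_marked h1 hs hf hρ hCF x).trans
    (dl_marked_le_dominant (dl_marked_finite h1 hs hf hρ x) (fun w => holeCost_nonneg _ _ _ _ _ _ _ w) fun w hw => hlaw w hw))

/-- ★★ **DOMINATION OF THE MOMENT (PROVED)**: under the domino law on the ball of `y`, `Ξ(y) ≤ Ξ_D(y)` (pools are non-negative). -/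
theorem dl_ballMoment_le_domMoment {s R_N unit r_f dK dstar κ c_T cχ τ ϱ r₁ r₂ : ℝ} {P : PeriodicConfiguration 3} {C X : Set E3}
    {c₀ : E3} {f : Fin 3 → E3} {ρ : ℝ} (h1 : IsSeparatedRef s P) (hs : 0 < s) (hf : Orthonormal ℝ f) (hρ : 0 < ρ)
    (hCF : IsCubicFrameOf P r₁ r₂ c₀ f ρ) (y : E3)
    (hlaw : ∀ x : E3, x ∈ P.points → dist x y ≤ R_N → ∀ w : Fin 3 → ℤ,
      IsDominant unit ϱ τ ρ (latDepth C c₀ f ρ) (IsMarked ϱχ D σ R_N r_f dK dstar κ c_T cχ P C X τ ϱ r₁ r₂ c₀ f ρ x) w →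
      domSum ϱχ D σ R_N r_f dK dstar κ c_T cχ P C X τ ϱ r₁ r₂ c₀ f ρ x w ≤ domCap unit ϱ τ ρ (chargeDepth ρ (latDepth C c₀ f ρ) w)) :
    ballMoment ϱχ D σ R_N r_f dK dstar κ c_T cχ P C X τ ϱ r₁ r₂ y ≤
      domMoment ϱχ D σ R_N unit r_f dK dstar κ c_T cχ P C X τ ϱ r₁ r₂ c₀ f ρ y := by
  unfold ballMoment domMoment
  set B := (h1.finite_inter_closedBall hs y R_N).toFinset with hB
  have hsupp : ∀ g : E3 → ℝ, Function.support (fun x : E3 => if x ∈ P.points ∧ dist x y ≤ R_N then g x else 0) ⊆ ↑B := by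
    intro g x hx
    rw [Function.mem_support] at hx
    rw [hB, Set.Finite.coe_toFinset]
    by_contra hc
    refine hx (if_neg fun hb => hc ⟨hb.1, ?_⟩)
    rw [Metric.mem_closedBall]
    exact hb.2
  refine fz_finsum_le B (hsupp fun x => pool ϱχ D σ r_f dK dstar κ c_T cχ P C X τ ϱ r₁ r₂ x *
      ballLoad ϱχ D σ R_N r_f dK dstar κ c_T cχ P C X τ ϱ r₁ r₂ x)
    (hsupp fun x => pool ϱχ D σ r_f dK dstar κ c_T cχ P C X τ ϱ r₁ r₂ x *
      domLoad ϱχ D σ R_N unit r_f dK dstar κ c_T cχ P C X τ ϱ r₁ r₂ c₀ f ρ x) fun x _ => ?_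
  by_cases hc : x ∈ P.points ∧ dist x y ≤ R_N
  · rw [if_pos hc, if_pos hc]
    exact mul_le_mul_of_nonneg_left (dl_ballLoad_le_domLoad h1 hs hf hρ hCF x (hlaw x hc.1 hc.2))
      (pool_nonneg r_f dK dstar κ c_T cχ P C X τ ϱ r₁ r₂ x)
  · rw [if_neg hc, if_neg hc]

/-- ★★★ **GLUE OF NODE 89 (PROVED)**: (DL) ∧ (DT) ⟹ (M¹) `BallMatchingSingleQ'`, for any class and constants with `0 < s`, `0 < ρlo`. -/
theorem ballMatchingSingleQ'_of_dominoLedger {cls : Set E3 → Prop} {R_N r_f dK dstar κ c_T cχ unit s lam ℓ τ ϱ ϱχ r₁ r₂ ρlo ρhi : ℝ}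
    (hs : 0 < s) (hlo : 0 < ρlo)
    (hL : DominoLawQ' cls R_N r_f dK dstar κ c_T cχ unit s lam ℓ τ ϱ ϱχ r₁ r₂ ρlo ρhi)
    (hM : DominoMatchingQ' cls R_N r_f dK dstar κ c_T cχ unit s lam ℓ τ ϱ ϱχ r₁ r₂ ρlo ρhi) :
    BallMatchingSingleQ' cls R_N r_f dK dstar κ c_T cχ s lam ℓ τ ϱ ϱχ r₁ r₂ ρlo ρhi := by
  intro P C X m D σ h1 h2 hcl h3 h4 h6 h7 h11 hcv hFr c₀ f ρ hf hρ1 hρ2 hCF y z hH hT hsc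
  obtain ⟨hPos, hMom⟩ := hM P C X m D σ h1 h2 hcl h3 h4 h6 h7 h11 hcv hFr c₀ f ρ hf hρ1 hρ2 hCF y z hH hT hsc
  exact ⟨hPos, (dl_ballMoment_le_domMoment h1 hs hf (hlo.trans_le hρ1) hCF y
    (hL P C X m D σ h1 h2 hcl h3 h4 h6 h7 h11 hcv hFr c₀ f ρ hf hρ1 hρ2 hCF y z hH hT hsc)).trans hMom⟩

end Glue89

end Summit.AtomisticToContinuum.Crystallization.Theorems.ChargedEnergyGapChartDial

end
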